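import Summits.BirchSwinnertonDyer.BirchSwinnertonDyer.Theorems.UniversalToricDescentDefectTransportOfAnalytic
import Summits.BirchSwinnertonDyer.BirchSwinnertonDyer.Theorems.UniversalToricDescentDefectTransportTorsionMu
import Summits.BirchSwinnertonDyer.BirchSwinnertonDyer.Theorems.UniversalToricDescentAnticyclotomicEulerFactor
import Summits.BirchSwinnertonDyer.BirchSwinnertonDyer.Theorems.UniversalToricDescentSigmaNormProfile
import HarnessLib

/-!
# Route UniversalToricDescent — act D's ♭T `DefectTransportModThree` IS the congruence of the Σ-depleted
# frames: `L·∏_{v∈Σ}𝒫_v(E) ≡ u·L′·∏_{v∈Σ}𝒫_v(E′) (mod 𝔪_{R₀})` ⟹ the analytic identity `hAn` of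
# `defectTransport_frames_of_analytic` ⟹ ♭T's conclusion at the frames

Lead prover bsd-wall-utd-p1 g12 (`--supports stmt-BirchSwinnertonDyer-26042`; sequel of
`UniversalToricDescentAnticyclotomicEulerFactor` (the Euler elements `𝒫_v(T) = P_v(q_v⁻¹(1+T)^{e_v}) ∈ Λ`, their
`T`-order `d_v · 3^{v_3(e_v)}` mod `3` and `d_v = s_v`) and of g11's `UniversalToricDescentDefectTransportOfAnalytic`
(♭T at a pair of frames from the analytic identity `m + Σ_v 3^{c_v} s_v(E) = m′ + Σ_v 3^{c_v} s_v(E′)`)).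

Greenberg–Vatsal's ANALYTIC half ((1.5), display (9); anticyclotomic BDP version Lei–Müller–Xia Thm. B /
Cor. 3.8, `p ∤ N`) is the congruence of the Σ-DEPLETED `p`-adic `L`-functions `L^Σ = L·∏_{v∈Σ}𝒫_v`,
`𝒫_v = P_v(N(v)⁻¹γ_v)`, of two residually isomorphic forms, up to a unit: it makes `μ` and `λ` of `L^Σ_E` and
`L^Σ_{E′}` equal, and `λ(L^Σ) = λ(L) + Σ_v λ(𝒫_v)` with `λ(𝒫_v) = (#places of K_∞ over v) · d_v`. This file
proves that implication in the route's `R₀⟦T⟧` norm-profile currency, with the exponents `e_v` abstract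
(`e_v ≠ 0`, `v_3(e_v) = c_v` where `κ(D_v) = 3^{c_v}ℤ₃`; for the BDP frames `γ_v = γ^{±e_v}`, either sign):

* (norm-profile algebra in `R₀⟦T⟧`: `UniversalToricDescentSigmaNormProfile` — profiles add under products,
  are stable under congruence mod `𝔪`, a left factor of a profiled product is profiled, `ord_T(F mod p)` in
  `Λ` is the profile in `R₀⟦T⟧`.)
* §1 `exists_normProfile_of_sigmaCongruence` — from `μ(L′) = 0` and the Σ-congruence: profiles `m, m′` of
  `L, L′` with `m + Σ_v d_v(E)·3^{v(e_v)} = m′ + Σ_v d_v(E′)·3^{v(e_v)}` (so `μ(L) = 0` TRANSPORTS);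
  `analyticIdentity_of_sigmaCongruence` — the same in the data of `hAn` (`3^{c_v}·s_v`, via `d_v = s_v`).
* §2 **`defectTransport_frames_of_sigmaCongruence`** — ♭T's binders, `X_{∅,0}(E)` torsion, the wall's
  inclusion at `L`, `μ(L′) = 0` (a ♭T hypothesis), the Σ-CONGRUENCE between `L` and `L′`, (iv), Poitou–Tate ×2,
  base finiteness ⟹ ♭T's `∃ g g′ n m n′ m′ …, n + m′ = n′ + m` VERBATIM at `(L, L′)`. So the research
  content of ♭T is ONE statement: the mod-`𝔪` congruence of the Σ-depleted BDP frames of `E` (additive,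
  `27 ∣ N`) and its `3`-congruent non-additive twin — unprinted at `p ∣ N` (LMX23 Thm. B needs `p ∤ N₁N₂`;
  Kriz–Li 2019 prove the VALUE congruence at the norm character allowing `p ∣ N`).

* §3 (appended) `defectTransport_torsionMu_of_sigmaCongruence` — given the Σ-congruence and `μ(𝓛′) = 0`, everything in
  ♭T's conclusion except the λ-identity holds on ALL classes with NO engine input (p611201's μ-part).

THEOREMS ONLY; no definition, no named fact, no `sorry`. BSD is not advanced by this file.
References: [GreenbergVatsal2000] Thm. (1.5), §1 display (9), §2 Prop. (2.4); [LeiMullerXia2023] Lemma 3.5,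
Cor. 3.8, Thm. B; [Castella2018] (3.1); [Washington1997] §7.1.
-/

set_option autoImplicit false
-- `…BirchSwinnertonDyer.BirchSwinnertonDyer.Theorems…` is the problem's mandated namespace (D-0017).
set_option linter.dupNamespace false

noncomputable section

open scoped Classical

/-! ### §1 The Σ-depleted congruence gives the analytic identity -/

namespace Summit.BirchSwinnertonDyer.BirchSwinnertonDyer.Theorems.UniversalToricDescentDefectTransport

open Function Field NumberField IsDedekindDomain WeierstrassCurve Polynomial
open Literature.NumberTheory.GaloisRepresentations Literature.NumberTheory.EllipticCurves
  Literature.NumberTheory.EllipticCurves.GreenbergSelmer Literature.NumberTheory.GaloisCohomology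
  Literature.NumberTheory.EllipticCurves.GreenbergVatsal2000
  Literature.NumberTheory.EllipticCurves.IwasawaAlgebra Literature.NumberTheory.EllipticCurves.Rank1Residual
  Summit.BirchSwinnertonDyer.Rank1Residual Summit.BirchSwinnertonDyer.Rank1Residual.X11b
  Summit.BirchSwinnertonDyer.Rank1Residual.X11b.Coinv Summit.BirchSwinnertonDyer.Rank1Residual.X11b.AcSelmer
  Summit.BirchSwinnertonDyer.Rank1Residual.X11b.LocBridge Summit.BirchSwinnertonDyer.Rank1Residual.Iwasawa
  Summit.BirchSwinnertonDyer.BirchSwinnertonDyer.Theorems.UniversalToricDescentNormProfile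
  Summit.BirchSwinnertonDyer.BirchSwinnertonDyer.Theorems.UniversalToricDescentAcEulerFactor
  Summit.BirchSwinnertonDyer.Rank1Residual.X2.EulerFactorAlgebra

/-- **Profiles of `L, L′` from `μ(L′) = 0` and the Σ-congruence.** For a number field `K`, Weierstrass curves
`E, E′` over `K`, a finite set `T` of places `v ∤ p`, exponents `e_v ≠ 0`, `L, L′ ∈ R₀⟦T⟧` with `μ(L′) = 0`
(a coefficient of norm `1`) and a unit `u` of `R₀⟦T⟧` with every coefficient of
`L·∏_{v∈T}𝒫_v(E) − u·L′·∏_{v∈T}𝒫_v(E′)` of norm `< 1` (`𝒫_v(·) = P_v(q_v⁻¹(1+T)^{e_v})` read in `R₀⟦T⟧`): there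
are norm profiles `m` of `L` and `m′` of `L′` with `m + Σ_v d_v(E)·p^{v_p(e_v)} = m′ + Σ_v d_v(E′)·p^{v_p(e_v)}`
— `μ` and the Σ-depleted `λ` transport (Greenberg–Vatsal (1.5) analytic half + display (9)).
[cite: GreenbergVatsal2000, Thm. (1.5) and §1 display (9)] [cite: LeiMullerXia2023, Lemma 3.5 and Cor. 3.8] -/
theorem exists_normProfile_of_sigmaCongruence {K : Type} [Field K] [NumberField K]
    (E E' : WeierstrassCurve K) {p : ℕ} [Fact p.Prime] (T : Finset (HeightOneSpectrum (𝓞 K)))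
    (hT : ∀ v ∈ T, ((p : ℕ) : 𝓞 K) ∉ v.asIdeal) (e : HeightOneSpectrum (𝓞 K) → ℤ_[p])
    (he : ∀ v ∈ T, e v ≠ 0) {L L' u : UnrSeries p}
    (hi' : ∃ i : ℕ, ‖((PowerSeries.coeff i L' : unrIntegers p) : ℂ_[p])‖ = 1) (hu : IsUnit u)
    (hcong : ∀ i : ℕ, ‖((PowerSeries.coeff i
        (L * PowerSeries.map (Halves.toUnr p) (∏ v ∈ T, (Polynomial.aeval
            (PowerSeries.C ((Nat.card (IsLocalRing.ResidueField (v.adicCompletionIntegers K)) : ℤ_[p]).inv) *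
              PowerSeries.binomialSeries ℤ_[p] (e v)) (E.localPolynomialAt v) : IwasawaAlgebra p)) -
          u * (L' * PowerSeries.map (Halves.toUnr p) (∏ v ∈ T, (Polynomial.aeval
            (PowerSeries.C ((Nat.card (IsLocalRing.ResidueField (v.adicCompletionIntegers K)) : ℤ_[p]).inv) *
              PowerSeries.binomialSeries ℤ_[p] (e v)) (E'.localPolynomialAt v) : IwasawaAlgebra p)))) :
        unrIntegers p) : ℂ_[p])‖ < 1) :
    ∃ m m' : ℕ,
      ((∀ i < m, ‖((PowerSeries.coeff i L : unrIntegers p) : ℂ_[p])‖ < 1) ∧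
        ‖((PowerSeries.coeff m L : unrIntegers p) : ℂ_[p])‖ = 1) ∧
      ((∀ i < m', ‖((PowerSeries.coeff i L' : unrIntegers p) : ℂ_[p])‖ < 1) ∧
        ‖((PowerSeries.coeff m' L' : unrIntegers p) : ℂ_[p])‖ = 1) ∧
      m + ∑ v ∈ T, (eulerFactorModP E p v).rootMultiplicity
            (((Nat.card (IsLocalRing.ResidueField (v.adicCompletionIntegers K)) : ℕ) : ZMod p)⁻¹) *
          p ^ (e v).valuation =
        m' + ∑ v ∈ T, (eulerFactorModP E' p v).rootMultiplicity
            (((Nat.card (IsLocalRing.ResidueField (v.adicCompletionIntegers K)) : ℕ) : ZMod p)⁻¹) *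
          p ^ (e v).valuation := by
  -- the Euler products have norm profiles `D = Σ d_v(E) p^{v(e_v)}` and `D′`
  obtain ⟨-, hordE⟩ := order_map_toZMod_prod_aeval_localPolynomialAt E T hT e he
  obtain ⟨-, hordE'⟩ := order_map_toZMod_prod_aeval_localPolynomialAt E' T hT e he
  have hPE := normProfile_map_toUnr_of_order_eq _ hordE
  have hPE' := normProfile_map_toUnr_of_order_eq _ hordE'
  -- `L′` has a profile `m′`; so `u·(L′·∏𝒫_v(E′))` has profile `m′ + D′`, hence `L·∏𝒫_v(E)` too
  classical
  have hm'lt : ∀ i < Nat.find hi', ‖((PowerSeries.coeff i L' : unrIntegers p) : ℂ_[p])‖ < 1 :=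
    fun i hi ↦ lt_of_le_of_ne (norm_coeff_le_one L' i) (Nat.find_min hi' hi)
  have hm' : ‖((PowerSeries.coeff (Nat.find hi') L' : unrIntegers p) : ℂ_[p])‖ = 1 := Nat.find_spec hi'
  set m' := Nat.find hi' with hm'def
  have h1 := normProfile_mul ⟨hm'lt, hm'⟩ hPE'
  have h2 := normProfile_mul_of_isUnit hu h1
  have h3 := normProfile_of_forall_norm_sub_lt hcong h2
  -- read off the profile of `L`
  obtain ⟨m, hm, hsum⟩ := exists_normProfile_left_of_mul hPE h3
  exact ⟨m, m', hm, ⟨hm'lt, hm'⟩, hsum⟩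

/-- **The analytic identity of ♭T from the Σ-congruence** — in the data of
`defectTransport_frames_of_analytic`'s hypothesis `hAn`: for `E = W_K`, `E′ = W′_K`, a `ℤ₃`-extension `κ`,
a finite set `T` of places `v ∤ 3` with exact indices `c_v` (`κ d₀ = 3^{c_v}` for some `d₀ ∈ D_v`) and local
exponents `#H¹(kerD κ v, ·[3^∞])[3] = 3^{s_v}, 3^{s′_v}`, exponents `e_v ≠ 0` with `v_3(e_v) = c_v`, `μ(L′) = 0`
and the Σ-congruence `L·∏𝒫_v(E) ≡ u·L′·∏𝒫_v(E′) (mod 𝔪)`: profiles `m, m′` with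
`m + Σ_v 3^{c_v} s_v = m′ + Σ_v 3^{c_v} s′_v` (the local terms match place by place: `λ(𝒫_v) = 3^{c_v}·d_v` and
`d_v = s_v`, `natCard_pTorsion_subgroupH1_kerD_eq_pow_rootMultiplicity`).
[cite: GreenbergVatsal2000, Thm. (1.5), §1 display (9), §2 Prop. (2.4)] [cite: LeiMullerXia2023, Cor. 3.8] -/
theorem analyticIdentity_of_sigmaCongruence (W W' : WeierstrassCurve ℚ) [W.IsElliptic] [W'.IsElliptic]
    (K : Type) [Field K] [NumberField K] (κ : ZpExtension K 3) (T : Finset (HeightOneSpectrum (𝓞 K)))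
    (c s s' : HeightOneSpectrum (𝓞 K) → ℕ) (hT : ∀ v ∈ T, ((3 : ℕ) : 𝓞 K) ∉ v.asIdeal)
    (hdata : ∀ v ∈ T,
      (∃ d₀ : decomp (K := K) v, (κ (d₀ : absoluteGaloisGroup K)).toAdd = (3 : ℤ_[3]) ^ c v) ∧
        (∀ d : decomp (K := K) v, (3 : ℤ_[3]) ^ c v ∣ (κ (d : absoluteGaloisGroup K)).toAdd) ∧
        Nat.card {f : subgroupH1 (kerD κ v) ((W.baseChange K).geomPrimaryTorsion 3) // 3 • f = 0} =
          3 ^ s v ∧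
        Nat.card {f : subgroupH1 (kerD κ v) ((W'.baseChange K).geomPrimaryTorsion 3) // 3 • f = 0} =
          3 ^ s' v)
    (e : HeightOneSpectrum (𝓞 K) → ℤ_[3]) (he : ∀ v ∈ T, e v ≠ 0 ∧ (e v).valuation = c v)
    {L L' u : UnrSeries 3}
    (hi' : ∃ i : ℕ, ‖((PowerSeries.coeff i L' : unrIntegers 3) : ℂ_[3])‖ = 1) (hu : IsUnit u)
    (hcong : ∀ i : ℕ, ‖((PowerSeries.coeff i
        (L * PowerSeries.map (Halves.toUnr 3) (∏ v ∈ T, (Polynomial.aeval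
            (PowerSeries.C ((Nat.card (IsLocalRing.ResidueField (v.adicCompletionIntegers K)) : ℤ_[3]).inv) *
              PowerSeries.binomialSeries ℤ_[3] (e v)) ((W.baseChange K).localPolynomialAt v) :
                IwasawaAlgebra 3)) -
          u * (L' * PowerSeries.map (Halves.toUnr 3) (∏ v ∈ T, (Polynomial.aeval
            (PowerSeries.C ((Nat.card (IsLocalRing.ResidueField (v.adicCompletionIntegers K)) : ℤ_[3]).inv) *
              PowerSeries.binomialSeries ℤ_[3] (e v)) ((W'.baseChange K).localPolynomialAt v) :
                IwasawaAlgebra 3)))) :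
        unrIntegers 3) : ℂ_[3])‖ < 1) :
    ∃ m m' : ℕ,
      ((∀ i < m, ‖((PowerSeries.coeff i L : unrIntegers 3) : ℂ_[3])‖ < 1) ∧
        ‖((PowerSeries.coeff m L : unrIntegers 3) : ℂ_[3])‖ = 1) ∧
      ((∀ i < m', ‖((PowerSeries.coeff i L' : unrIntegers 3) : ℂ_[3])‖ < 1) ∧
        ‖((PowerSeries.coeff m' L' : unrIntegers 3) : ℂ_[3])‖ = 1) ∧
      m + ∑ v ∈ T, 3 ^ c v * s v = m' + ∑ v ∈ T, 3 ^ c v * s' v := by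
  haveI : Fact (Nat.Prime 3) := ⟨Nat.prime_three⟩
  obtain ⟨m, m', hm, hm', hsum⟩ := exists_normProfile_of_sigmaCongruence (W.baseChange K) (W'.baseChange K)
    T hT e (fun v hv ↦ (he v hv).1) hi' hu hcong
  refine ⟨m, m', hm, hm', ?_⟩
  -- `d_v · 3^{v(e_v)} = 3^{c_v} · s_v` place by place
  have hD : ∀ v ∈ T, ¬ (decomp v ≤ κ.kerSubgroup) := by
    intro v hv hle
    obtain ⟨⟨d₀, hd₀⟩, -⟩ := hdata v hv
    have h1 : κ (d₀ : absoluteGaloisGroup K) = 1 := (ZpExtension.mem_kerSubgroup).mp (hle d₀.2)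
    rw [h1, toAdd_one] at hd₀
    exact pow_ne_zero (c v) (by norm_num : (3 : ℤ_[3]) ≠ 0) hd₀.symm
  have hloc : ∀ v ∈ T,
      (eulerFactorModP (W.baseChange K) 3 v).rootMultiplicity
            (((Nat.card (IsLocalRing.ResidueField (v.adicCompletionIntegers K)) : ℕ) : ZMod 3)⁻¹) *
          3 ^ (e v).valuation = 3 ^ c v * s v ∧
        (eulerFactorModP (W'.baseChange K) 3 v).rootMultiplicity
            (((Nat.card (IsLocalRing.ResidueField (v.adicCompletionIntegers K)) : ℕ) : ZMod 3)⁻¹) *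
          3 ^ (e v).valuation = 3 ^ c v * s' v := by
    intro v hv
    obtain ⟨-, -, hs, hs'⟩ := hdata v hv
    rw [natCard_pTorsion_subgroupH1_kerD_eq_pow_rootMultiplicity (W.baseChange K) v κ (hT v hv) (hD v hv)]
      at hs
    rw [natCard_pTorsion_subgroupH1_kerD_eq_pow_rootMultiplicity (W'.baseChange K) v κ (hT v hv) (hD v hv)]
      at hs'
    have h3 : Function.Injective (fun k : ℕ ↦ 3 ^ k) := Nat.pow_right_injective (by norm_num)
    have hsd := h3 hs
    have hsd' := h3 hs'
    rw [hsd, hsd', (he v hv).2]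
    exact ⟨mul_comm _ _, mul_comm _ _⟩
  rw [Finset.sum_congr rfl fun v hv ↦ (hloc v hv).1, Finset.sum_congr rfl fun v hv ↦ (hloc v hv).2] at hsum
  exact hsum

/-! ### §2 ♭T at a pair of frames from the Σ-congruence -/

/-- **♭T's conclusion at a pair of frames, from the Σ-DEPLETED CONGRUENCE.** ♭T binders (E of Kodaira class O6
at `3`, mod-`3` twin `E′`, Heegner `K` for `N, N′`, anticyclotomic `κ` with generator `γ`, `𝔭′ ∋ 3`),
`X_{∅,0}(E)` torsion, the wall's inclusion `(𝓛) ⊆ Ch(E)·R₀⟦T⟧`, `μ(𝓛′) = 0`, and THE RESEARCH INPUT `hSigma`: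
«for the finite bad set `T` and its exact indices `c_v` there are exponents `e_v ≠ 0` with `v_3(e_v) = c_v` and
a unit `u` of `R₀⟦T⟧` with `𝓛·∏_{v∈T}𝒫_v(E) ≡ u·𝓛′·∏_{v∈T}𝒫_v(E′) (mod 𝔪_{R₀})` coefficientwise» (the
congruence of the Σ-depleted BDP frames, `𝒫_v(·) = P_v(q_v⁻¹(1+T)^{e_v})`), plus (iv), Poitou–Tate ×2 and base
finiteness for `E, E′` (the ENGINE's inputs) ⟹ `∃ g g′ n m n′ m′`: `Ch(E)·R₀⟦T⟧ = (g)`, `Ch(E′)·R₀⟦T⟧ = (g′)`,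
`profile_n(g)`, `profile_m(𝓛)`, `profile_{n′}(g′)`, `profile_{m′}(𝓛′)`, `n + m′ = n′ + m` — the conclusion of
`DefectTransportModThree` verbatim (`μ(𝓛) = 0` is DERIVED from `hSigma` and `μ(𝓛′) = 0`).
[cite: GreenbergVatsal2000, Thm. (1.4) and (1.5), §2 (pp. 20–28)] [cite: LeiMullerXia2023, Cor. 3.8 and Thm. B]
[cite: Brink2007, Thm. 2 and Cor. 1] -/
theorem defectTransport_frames_of_sigmaCongruence (W W' : WeierstrassCurve ℚ) [W.IsElliptic]
    [W.IsGloballyMinimal] [W'.IsElliptic] [W'.IsGloballyMinimal] {N N' : ℕ} (K : Type) [Field K]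
    [NumberField K]
    (hO6 : Additive.ClassO6 W 3) (hN : W.conductorNorm ℤ = N) (hcong : O6.ModPCongruent W' W 3)
    (hN' : W'.conductorNorm ℤ = N') (hK : IsImaginaryQuadratic K)
    (hHe : SatisfiesHeegnerHypothesis N K) (hHe' : SatisfiesHeegnerHypothesis N' K)
    (κ : ZpExtension K 3) (hκ : κ.IsAnticyclotomic) (γ : absoluteGaloisGroup K)
    [Fact (κ.IsTopGenerator γ)] {𝔭' : HeightOneSpectrum (𝓞 K)} (h𝔭' : ((3 : ℕ) : 𝓞 K) ∈ 𝔭'.asIdeal)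
    (hT : Module.IsTorsion (IwasawaAlgebra 3) (XAc (W.baseChange K) 3 κ 𝔭' ∅ γ))
    {L L' : UnrSeries 3}
    (hle : Ideal.span {L} ≤
      (XAc.charIdeal (W.baseChange K) 3 κ 𝔭' ∅ γ).map (PowerSeries.map (Halves.toUnr 3)))
    (hi' : ∃ i : ℕ, ‖((PowerSeries.coeff i L' : unrIntegers 3) : ℂ_[3])‖ = 1)
    (hSigma : ∀ (T : Finset (HeightOneSpectrum (𝓞 K))) (c : HeightOneSpectrum (𝓞 K) → ℕ),
      (↑T = {v : HeightOneSpectrum (𝓞 K) | ((3 : ℕ) : 𝓞 K) ∉ v.asIdeal ∧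
        (¬ (W.baseChange K).HasGoodReductionAt v ∨ ¬ (W'.baseChange K).HasGoodReductionAt v)}) →
      (∀ v ∈ T, (∃ d₀ : decomp (K := K) v, (κ (d₀ : absoluteGaloisGroup K)).toAdd = (3 : ℤ_[3]) ^ c v) ∧
        (∀ d : decomp (K := K) v, (3 : ℤ_[3]) ^ c v ∣ (κ (d : absoluteGaloisGroup K)).toAdd)) →
      ∃ (e : HeightOneSpectrum (𝓞 K) → ℤ_[3]) (u : UnrSeries 3), IsUnit u ∧
        (∀ v ∈ T, e v ≠ 0 ∧ (e v).valuation = c v) ∧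
        ∀ i : ℕ, ‖((PowerSeries.coeff i
          (L * PowerSeries.map (Halves.toUnr 3) (∏ v ∈ T, (Polynomial.aeval
              (PowerSeries.C ((Nat.card (IsLocalRing.ResidueField (v.adicCompletionIntegers K)) : ℤ_[3]).inv) *
                PowerSeries.binomialSeries ℤ_[3] (e v)) ((W.baseChange K).localPolynomialAt v) :
                  IwasawaAlgebra 3)) -
            u * (L' * PowerSeries.map (Halves.toUnr 3) (∏ v ∈ T, (Polynomial.aeval
              (PowerSeries.C ((Nat.card (IsLocalRing.ResidueField (v.adicCompletionIntegers K)) : ℤ_[3]).inv) *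
                PowerSeries.binomialSeries ℤ_[3] (e v)) ((W'.baseChange K).localPolynomialAt v) :
                  IwasawaAlgebra 3)))) :
          unrIntegers 3) : ℂ_[3])‖ < 1)
    (h4 : ∀ R : (W.baseChange ℚ_[3]).toAffine.Point, 3 • R = 0 → R = 0)
    (hPT : poitouTate_selmerStructure_duality K) (hPT2 : poitouTate_sha_tateDual K)
    (hfin : ∀ v : HeightOneSpectrum (𝓞 K), ((3 : ℕ) : 𝓞 K) ∈ v.asIdeal →
      Finite (selmerAcBase (W.baseChange K) 3 v ∅))
    (hfin' : ∀ v : HeightOneSpectrum (𝓞 K), ((3 : ℕ) : 𝓞 K) ∈ v.asIdeal →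
      Finite (selmerAcBase (W'.baseChange K) 3 v ∅)) :
    ∃ (g g' : UnrSeries 3) (n m n' m' : ℕ),
      (XAc.charIdeal (W.baseChange K) 3 κ 𝔭' ∅ γ).map (PowerSeries.map (Halves.toUnr 3)) =
          Ideal.span {g} ∧
        (XAc.charIdeal (W'.baseChange K) 3 κ 𝔭' ∅ γ).map (PowerSeries.map (Halves.toUnr 3)) =
          Ideal.span {g'} ∧
        ((∀ i < n, ‖((PowerSeries.coeff i g : unrIntegers 3) : ℂ_[3])‖ < 1) ∧
          ‖((PowerSeries.coeff n g : unrIntegers 3) : ℂ_[3])‖ = 1) ∧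
        ((∀ i < m, ‖((PowerSeries.coeff i L : unrIntegers 3) : ℂ_[3])‖ < 1) ∧
          ‖((PowerSeries.coeff m L : unrIntegers 3) : ℂ_[3])‖ = 1) ∧
        ((∀ i < n', ‖((PowerSeries.coeff i g' : unrIntegers 3) : ℂ_[3])‖ < 1) ∧
          ‖((PowerSeries.coeff n' g' : unrIntegers 3) : ℂ_[3])‖ = 1) ∧
        ((∀ i < m', ‖((PowerSeries.coeff i L' : unrIntegers 3) : ℂ_[3])‖ < 1) ∧
          ‖((PowerSeries.coeff m' L' : unrIntegers 3) : ℂ_[3])‖ = 1) ∧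
        n + m' = n' + m := by
  haveI : Fact (Nat.Prime 3) := ⟨Nat.prime_three⟩
  -- the finite bad set `T` and its exact indices `c_v`, to instantiate `hSigma` once for `μ(𝓛) = 0`
  set S : Set (HeightOneSpectrum (𝓞 K)) := {v | ((3 : ℕ) : 𝓞 K) ∉ v.asIdeal ∧
    (¬ (W.baseChange K).HasGoodReductionAt v ∨ ¬ (W'.baseChange K).HasGoodReductionAt v)} with hSdef
  have hSfin : S.Finite := by
    refine (((W.baseChange K).finite_badPlaces_holds (𝓞 K)).union
      ((W'.baseChange K).finite_badPlaces_holds (𝓞 K))).subset fun v hv ↦ ?_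
    rcases hv.2 with h | h
    · exact Or.inl h
    · exact Or.inr h
  have hSdec : ∀ v ∈ S, ¬ (decomp v ≤ κ.kerSubgroup) := by
    intro v hv
    rcases hv.2 with h | h
    · exact UniversalToricDescentTorsionMuTransportHeegner.not_decomp_le_kerSubgroup_of_not_hasGoodReductionAt_baseChange
        W hN K hK hHe (by decide) κ hκ hv.1 h
    · exact UniversalToricDescentTorsionMuTransportHeegner.not_decomp_le_kerSubgroup_of_not_hasGoodReductionAt_baseChange
        W' hN' K hK hHe' (by decide) κ hκ hv.1 h
  choose! c₀ hc₀ using fun v (hv : v ∈ hSfin.toFinset) ↦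
    UniversalToricDescentSigmaLocalStabilizer.exists_pow_and_forall_dvd_of_not_le κ v
      (hSdec v (hSfin.mem_toFinset.mp hv))
  obtain ⟨e₀, u₀, hu₀, he₀, hcong₀⟩ := hSigma hSfin.toFinset c₀ (by rw [Set.Finite.coe_toFinset])
    (fun v hv ↦ ⟨(hc₀ v hv).1, (hc₀ v hv).2.2⟩)
  -- `μ(𝓛) = 0` transports from `μ(𝓛′) = 0` along the congruence
  have hi : ∃ i : ℕ, ‖((PowerSeries.coeff i L : unrIntegers 3) : ℂ_[3])‖ = 1 := by
    obtain ⟨m, -, hm, -, -⟩ := exists_normProfile_of_sigmaCongruence (W.baseChange K) (W'.baseChange K)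
      hSfin.toFinset (fun v hv ↦ (hSfin.mem_toFinset.mp hv).1) e₀ (fun v hv ↦ (he₀ v hv).1) hi' hu₀ hcong₀
    exact ⟨m, hm.2⟩
  -- the analytic identity `hAn` from `hSigma`, then g11's reduction
  refine defectTransport_frames_of_analytic W W' K hO6 hN hcong hN' hK hHe hHe' κ hκ γ h𝔭' hT hle hi
    (fun T c s s' hTS hdata ↦ ?_) h4 hPT hPT2 hfin hfin'
  have hTp : ∀ v ∈ T, ((3 : ℕ) : 𝓞 K) ∉ v.asIdeal := fun v hv ↦ by
    have h : v ∈ (↑T : Set (HeightOneSpectrum (𝓞 K))) := Finset.mem_coe.mpr hv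
    rw [hTS] at h
    exact h.1
  obtain ⟨e, u, hu, he, hcongT⟩ := hSigma T c hTS (fun v hv ↦ ⟨(hdata v hv).1, (hdata v hv).2.1⟩)
  exact analyticIdentity_of_sigmaCongruence W W' K κ T c s s' hTp hdata e he hi' hu hcongT

/-! ### §3 (appended, utd-p1 g12) The `μ`-part from the Σ-congruence — on ALL classes, no engine inputs -/

/-- **♭T's conclusion minus the λ-count, from the Σ-congruence ALONE (no (iv), no Poitou–Tate, no base finiteness).**
♭T binders (conductors, mod-`3` congruence, Heegner `K` for `N, N′`, anticyclotomic `κ`, `𝔭′ ∋ 3`), `X_{∅,0}(E)` torsion,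
the wall's inclusion at `𝓛`, `μ(𝓛′) = 0`, and the Σ-congruence between `𝓛` and `𝓛′` (stated at the finite bad set with ANY
exact indices, as in `defectTransport_frames_of_sigmaCongruence`) ⟹ `μ(𝓛) = 0` (a norm-one coefficient), `μ(X_{∅,0}(E)) = 0`,
`X_{∅,0}(E′)` torsion with `μ = 0`, and generators of both `Ch·R₀⟦T⟧` with norm profiles `λ_alg(E)`, `λ_alg(E′)`
(`exists_normProfile_of_sigmaCongruence` + p611201 `defectTransport_torsionMu_of_wall`). So given the Σ-congruence the ONLY
part of ♭T that still needs the engine's inputs is the identity `n + m′ = n′ + m`.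
[cite: GreenbergVatsal2000, Thm. (1.4) and (1.5)] [cite: Brink2007, Thm. 2 and Cor. 1] -/
theorem defectTransport_torsionMu_of_sigmaCongruence (W W' : WeierstrassCurve ℚ) [W.IsElliptic]
    [W'.IsElliptic] {N N' : ℕ} (K : Type) [Field K] [NumberField K]
    (hN : W.conductorNorm ℤ = N) (hcong : O6.ModPCongruent W' W 3)
    (hN' : W'.conductorNorm ℤ = N') (hK : IsImaginaryQuadratic K)
    (hHe : SatisfiesHeegnerHypothesis N K) (hHe' : SatisfiesHeegnerHypothesis N' K)
    (κ : ZpExtension K 3) (hκ : κ.IsAnticyclotomic) (γ : absoluteGaloisGroup K)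
    [Fact (κ.IsTopGenerator γ)] {𝔭' : HeightOneSpectrum (𝓞 K)} (h𝔭' : ((3 : ℕ) : 𝓞 K) ∈ 𝔭'.asIdeal)
    (hT : Module.IsTorsion (IwasawaAlgebra 3) (XAc (W.baseChange K) 3 κ 𝔭' ∅ γ))
    {L L' : UnrSeries 3}
    (hle : Ideal.span {L} ≤
      (XAc.charIdeal (W.baseChange K) 3 κ 𝔭' ∅ γ).map (PowerSeries.map (Halves.toUnr 3)))
    (hi' : ∃ i : ℕ, ‖((PowerSeries.coeff i L' : unrIntegers 3) : ℂ_[3])‖ = 1)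
    (hSigma : ∀ (T : Finset (HeightOneSpectrum (𝓞 K))) (c : HeightOneSpectrum (𝓞 K) → ℕ),
      (↑T = {v : HeightOneSpectrum (𝓞 K) | ((3 : ℕ) : 𝓞 K) ∉ v.asIdeal ∧
        (¬ (W.baseChange K).HasGoodReductionAt v ∨ ¬ (W'.baseChange K).HasGoodReductionAt v)}) →
      (∀ v ∈ T, (∃ d₀ : decomp (K := K) v, (κ (d₀ : absoluteGaloisGroup K)).toAdd = (3 : ℤ_[3]) ^ c v) ∧
        (∀ d : decomp (K := K) v, (3 : ℤ_[3]) ^ c v ∣ (κ (d : absoluteGaloisGroup K)).toAdd)) →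
      ∃ (e : HeightOneSpectrum (𝓞 K) → ℤ_[3]) (u : UnrSeries 3), IsUnit u ∧
        (∀ v ∈ T, e v ≠ 0 ∧ (e v).valuation = c v) ∧
        ∀ i : ℕ, ‖((PowerSeries.coeff i
          (L * PowerSeries.map (Halves.toUnr 3) (∏ v ∈ T, (Polynomial.aeval
              (PowerSeries.C ((Nat.card (IsLocalRing.ResidueField (v.adicCompletionIntegers K)) : ℤ_[3]).inv) *
                PowerSeries.binomialSeries ℤ_[3] (e v)) ((W.baseChange K).localPolynomialAt v) :
                  IwasawaAlgebra 3)) -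
            u * (L' * PowerSeries.map (Halves.toUnr 3) (∏ v ∈ T, (Polynomial.aeval
              (PowerSeries.C ((Nat.card (IsLocalRing.ResidueField (v.adicCompletionIntegers K)) : ℤ_[3]).inv) *
                PowerSeries.binomialSeries ℤ_[3] (e v)) ((W'.baseChange K).localPolynomialAt v) :
                  IwasawaAlgebra 3)))) :
          unrIntegers 3) : ℂ_[3])‖ < 1) :
    (∃ i : ℕ, ‖((PowerSeries.coeff i L : unrIntegers 3) : ℂ_[3])‖ = 1) ∧
      muInvariant 3 (XAc (W.baseChange K) 3 κ 𝔭' ∅ γ) = 0 ∧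
      (∃ g : UnrSeries 3,
        (XAc.charIdeal (W.baseChange K) 3 κ 𝔭' ∅ γ).map (PowerSeries.map (Halves.toUnr 3)) =
            Ideal.span {g} ∧
          (∀ i < lambdaInvariant 3 (XAc (W.baseChange K) 3 κ 𝔭' ∅ γ),
            ‖((PowerSeries.coeff i g : unrIntegers 3) : ℂ_[3])‖ < 1) ∧
          ‖((PowerSeries.coeff (lambdaInvariant 3 (XAc (W.baseChange K) 3 κ 𝔭' ∅ γ)) g :
            unrIntegers 3) : ℂ_[3])‖ = 1) ∧
      Module.IsTorsion (IwasawaAlgebra 3) (XAc (W'.baseChange K) 3 κ 𝔭' ∅ γ) ∧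
      muInvariant 3 (XAc (W'.baseChange K) 3 κ 𝔭' ∅ γ) = 0 ∧
      (∃ g' : UnrSeries 3,
        (XAc.charIdeal (W'.baseChange K) 3 κ 𝔭' ∅ γ).map (PowerSeries.map (Halves.toUnr 3)) =
            Ideal.span {g'} ∧
          (∀ i < lambdaInvariant 3 (XAc (W'.baseChange K) 3 κ 𝔭' ∅ γ),
            ‖((PowerSeries.coeff i g' : unrIntegers 3) : ℂ_[3])‖ < 1) ∧
          ‖((PowerSeries.coeff (lambdaInvariant 3 (XAc (W'.baseChange K) 3 κ 𝔭' ∅ γ)) g' :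
            unrIntegers 3) : ℂ_[3])‖ = 1) := by
  haveI : Fact (Nat.Prime 3) := ⟨Nat.prime_three⟩
  -- the finite bad set and its exact indices, to instantiate `hSigma`
  set S : Set (HeightOneSpectrum (𝓞 K)) := {v | ((3 : ℕ) : 𝓞 K) ∉ v.asIdeal ∧
    (¬ (W.baseChange K).HasGoodReductionAt v ∨ ¬ (W'.baseChange K).HasGoodReductionAt v)} with hSdef
  have hSfin : S.Finite := by
    refine (((W.baseChange K).finite_badPlaces_holds (𝓞 K)).union
      ((W'.baseChange K).finite_badPlaces_holds (𝓞 K))).subset fun v hv ↦ ?_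
    rcases hv.2 with h | h
    · exact Or.inl h
    · exact Or.inr h
  have hSdec : ∀ v ∈ S, ¬ (decomp v ≤ κ.kerSubgroup) := by
    intro v hv
    rcases hv.2 with h | h
    · exact UniversalToricDescentTorsionMuTransportHeegner.not_decomp_le_kerSubgroup_of_not_hasGoodReductionAt_baseChange
        W hN K hK hHe (by decide) κ hκ hv.1 h
    · exact UniversalToricDescentTorsionMuTransportHeegner.not_decomp_le_kerSubgroup_of_not_hasGoodReductionAt_baseChange
        W' hN' K hK hHe' (by decide) κ hκ hv.1 h
  choose! c₀ hc₀ using fun v (hv : v ∈ hSfin.toFinset) ↦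
    UniversalToricDescentSigmaLocalStabilizer.exists_pow_and_forall_dvd_of_not_le κ v
      (hSdec v (hSfin.mem_toFinset.mp hv))
  obtain ⟨e₀, u₀, hu₀, he₀, hcong₀⟩ := hSigma hSfin.toFinset c₀ (by rw [Set.Finite.coe_toFinset])
    (fun v hv ↦ ⟨(hc₀ v hv).1, (hc₀ v hv).2.2⟩)
  -- `μ(𝓛) = 0` transported from `μ(𝓛′) = 0`
  have hi : ∃ i : ℕ, ‖((PowerSeries.coeff i L : unrIntegers 3) : ℂ_[3])‖ = 1 := by
    obtain ⟨m, -, hm, -, -⟩ := exists_normProfile_of_sigmaCongruence (W.baseChange K) (W'.baseChange K)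
      hSfin.toFinset (fun v hv ↦ (hSfin.mem_toFinset.mp hv).1) e₀ (fun v hv ↦ (he₀ v hv).1) hi' hu₀ hcong₀
    exact ⟨m, hm.2⟩
  exact ⟨hi, defectTransport_torsionMu_of_wall W W' K hN hcong hN' hK hHe hHe' κ hκ γ h𝔭' hT hle hi⟩

end Summit.BirchSwinnertonDyer.BirchSwinnertonDyer.Theorems.UniversalToricDescentDefectTransport

end
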